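import Summits.CriticalPhenomena.PercolationContinuityZ3.Theorems.PercNearOneGluingNoHeavyLowerTailKnQuestion8CoefficientwiseRootSetKernelRowTwoNonAdj
import Summits.CriticalPhenomena.PercolationContinuityZ3.Theorems.PercNearOneGluingNoHeavyLowerTailKnQuestion8CoefficientwiseRootSetKernelRowTwoIsolated
import HarnessLib

/-!
# The root-set kernel: ROW 2 of RCSET when `q` is not attached to `U` (the pendant case `a = 0`) — prim-lf-2 gen 60

Support file (`--supports stmt-CriticalPhenomena-4575`, closed), prover `prim-lf-2` (gen 60).  No definitions, no named facts, no sorries; standard axioms.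
Memo `prim-lf-2/CW-ATOM-gen60.md` §5; companions `…RootSetKernelRowTwoIsolated.lean` (`rcset_row_two_isolated`, `pendant_powerset_sum`), `…RootSetKernelRowTwo.lean` /
`…RowTwoNonAdj.lean` (row 2 with `U ∼ q`, `U ∼ y`), `…RootSetKernelRowTwoPrep.lean` (set-cluster primitives, `sum_powerset_union_of_disjoint`).

Kernel notation as in those files: `R_A(t) = {v | ∃ a ∈ A, v ∈ C_a(t)}`, `B_A(t) = R_A(E ∖ t)`, `Φ(A,A') = Σ_{t ⊆ E : ¬(y∈R_A(t) ∧ y∈B_{A'}(t))} T(R_A(t), B_{A'}(t))`.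
* `Coefficientwise.rcset_row_two_noAq` — **THEOREM: ROW 2 of RCSET when no edge joins `U = V ∖ {y,q}` to `q`** (any number of `q–y` and `U–y` edges):  `Φ(U,U) ≤ 2·Φ(S,U)`.
Proof (memo §5).  Write `t = t₀ ∪ γ` with `γ ⊆ Cq` (the `q–y` edges) and `t₀ ⊆ E₀ = E ∖ Cq`.  Since `q` has no other non-loop edge, `R_U(t) = R_U(t₀) + q[y ∈ R_U(t₀) ∧ γ ≠ ∅]`,
`B_U(t) = B₀ + q[y ∈ B₀ ∧ γ ≠ Cq]` (`B₀ = R_U(E₀ ∖ t₀)`), the same for `R_S`, and admissibility does not depend on `γ` (exploration lemma `setCluster_union_eq_of_not_mem`).  Summing over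
`γ` (`pendant_powerset_sum`) gives `Φ_G(U,U) = Φ⁰_f(U,U) + (2^c − 1)·Φ⁰_{f̃}(U,U)` and `Φ_G(S,U) = Φ⁰_f(S,U) + (2^c − 1)·Φ⁰_{f̃}(S,U)`, where `Φ⁰` is the kernel of `(ends, E₀, y)`
(in which `q` is isolated) and `f̃(X) = f(X + q[y ∈ X])` (monotone).  Two applications of `rcset_row_two_isolated` (i.e. of the top row).
[cite: KozmaNitzan2024, Questions 8–9 (§5.5 p. 36) (context: the Question-8 pocket covariance programme)]
-/

namespace Summit.CriticalPhenomena.PercolationContinuityZ3.Theorems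

open Finset Literature.Probability.Percolation

namespace Coefficientwise

variable {ι V : Type*}

open Classical in
/-- **Row 2 of RCSET, pendant case `a = 0`** (see the module docstring): for finite `V`, `y ≠ q`, `U = V ∖ {y, q}`, `y, q ∉ S`, monotone `f, g`, and NO edge of `E` joining `q` to a
vertex of `U`:  `Φ(U,U) ≤ 2·Φ(S,U)` for the root-set kernel `Φ` of `(ends, E, y, f, g)`. [cite: KozmaNitzan2024, Questions 8–9 (§5.5 p. 36) (context)] -/
theorem rcset_row_two_noAq [Fintype V] [DecidableEq V] (ends : ι → Sym2 V) (E : Finset ι) (y q : V) (hyq : y ≠ q) (S : Finset V) (hyS : y ∉ S) (hqS : q ∉ S)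
    (hnAq : ∀ i ∈ E, ∀ u : V, u ≠ q → u ≠ y → ends i ≠ s(u, q))
    (f g : Set V → ℝ) (hf : Monotone f) (hg : Monotone g) :
    (∑ s ∈ E.powerset.filter (fun s : Finset ι =>
          ¬ ((∃ a ∈ ((Finset.univ : Finset V).erase y).erase q, y ∈ openCluster (ends '' (↑s : Set ι)) a) ∧
             (∃ a ∈ ((Finset.univ : Finset V).erase y).erase q, y ∈ openCluster (ends '' (↑(E \ s) : Set ι)) a))),
        (f {v | ∃ a ∈ ((Finset.univ : Finset V).erase y).erase q, v ∈ openCluster (ends '' (↑s : Set ι)) a} -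
            f {v | ∃ a ∈ ((Finset.univ : Finset V).erase y).erase q, v ∈ openCluster (ends '' (↑(E \ s) : Set ι)) a}) *
          (g {v | ∃ a ∈ ((Finset.univ : Finset V).erase y).erase q, v ∈ openCluster (ends '' (↑s : Set ι)) a} -
            g {v | ∃ a ∈ ((Finset.univ : Finset V).erase y).erase q, v ∈ openCluster (ends '' (↑(E \ s) : Set ι)) a})) ≤
    2 * ∑ s ∈ E.powerset.filter (fun s : Finset ι =>
          ¬ ((∃ a ∈ S, y ∈ openCluster (ends '' (↑s : Set ι)) a) ∧
             (∃ a ∈ ((Finset.univ : Finset V).erase y).erase q, y ∈ openCluster (ends '' (↑(E \ s) : Set ι)) a))),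
        (f {v | ∃ a ∈ S, v ∈ openCluster (ends '' (↑s : Set ι)) a} -
            f {v | ∃ a ∈ ((Finset.univ : Finset V).erase y).erase q, v ∈ openCluster (ends '' (↑(E \ s) : Set ι)) a}) *
          (g {v | ∃ a ∈ S, v ∈ openCluster (ends '' (↑s : Set ι)) a} -
            g {v | ∃ a ∈ ((Finset.univ : Finset V).erase y).erase q, v ∈ openCluster (ends '' (↑(E \ s) : Set ι)) a}) := by
  -- notation
  set U : Finset V := ((Finset.univ : Finset V).erase y).erase q with hU
  set RU : Finset ι → Set V := fun t => {v | ∃ a ∈ U, v ∈ openCluster (ends '' (↑t : Set ι)) a} with hRU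
  set RS : Finset ι → Set V := fun t => {v | ∃ a ∈ S, v ∈ openCluster (ends '' (↑t : Set ι)) a} with hRS
  set admU : Finset ι → Prop := fun s => ¬ ((∃ a ∈ U, y ∈ openCluster (ends '' (↑s : Set ι)) a) ∧
      (∃ a ∈ U, y ∈ openCluster (ends '' (↑(E \ s) : Set ι)) a)) with hadmU
  set admS : Finset ι → Prop := fun s => ¬ ((∃ a ∈ S, y ∈ openCluster (ends '' (↑s : Set ι)) a) ∧
      (∃ a ∈ U, y ∈ openCluster (ends '' (↑(E \ s) : Set ι)) a)) with hadmS
  set TU : Finset ι → ℝ := fun s => (f (RU s) - f (RU (E \ s))) * (g (RU s) - g (RU (E \ s))) with hTU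
  set TS : Finset ι → ℝ := fun s => (f (RS s) - f (RU (E \ s))) * (g (RS s) - g (RU (E \ s))) with hTS
  change ∑ s ∈ E.powerset.filter admU, TU s ≤ 2 * ∑ s ∈ E.powerset.filter admS, TS s
  /- ### vertices -/
  have hyU : y ∉ U := fun h => (Finset.mem_erase.mp (Finset.mem_erase.mp h).2).1 rfl
  have hqU : q ∉ U := fun h => (Finset.mem_erase.mp h).1 rfl
  have memU : ∀ v : V, v ≠ q → v ≠ y → v ∈ U := fun v h1 h2 => Finset.mem_erase.mpr ⟨h1, Finset.mem_erase.mpr ⟨h2, Finset.mem_univ v⟩⟩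
  /- ### edge classes: the `q–y` edges `Cq` and the rest `E₀` -/
  set Cq : Finset ι := E.filter (fun i => ends i = s(q, y)) with hCqdef
  set E₀ : Finset ι := E \ Cq with hE₀
  have hCqE : Cq ⊆ E := Finset.filter_subset _ E
  have hE₀E : E₀ ⊆ E := Finset.sdiff_subset
  have endsCq : ∀ i ∈ Cq, ends i = s(q, y) := fun i hi => (Finset.mem_filter.mp hi).2
  have hdisj : Disjoint E₀ Cq := Finset.sdiff_disjoint
  have hEE : E₀ ∪ Cq = E := Finset.sdiff_union_of_subset hCqE
  -- `q` has no non-loop edge in `E₀`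
  have q_isol : ∀ i ∈ E₀, ∀ w : V, w ≠ q → ends i ≠ s(w, q) := by
    intro i hi w hwq h
    obtain ⟨hiE, hiC⟩ := Finset.mem_sdiff.mp hi
    by_cases hwy : w = y
    · exact hiC (Finset.mem_filter.mpr ⟨hiE, by rw [h, hwy, Sym2.eq_swap]⟩)
    · exact hnAq i hiE w hwq hwy h
  /- ### cluster facts on `E₀` -/
  -- `q` is never reached from a set not containing it
  have q_notin : ∀ (A : Finset V) (t : Finset ι), q ∉ A → t ⊆ E₀ → q ∉ {v | ∃ a ∈ A, v ∈ openCluster (ends '' (↑t : Set ι)) a} :=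
    fun A t hqA ht => not_mem_setCluster_of_isolated ends hqA fun i hi w hwq => q_isol i (ht hi) w hwq
  -- exploration: the `Cq` edges are not used unless `y` is reached; and if `y` is reached they add exactly `q`
  have explore : ∀ (A : Finset V) (t γ : Finset ι), q ∉ A → t ⊆ E₀ → γ ⊆ Cq →
      (y ∉ {v | ∃ a ∈ A, v ∈ openCluster (ends '' (↑t : Set ι)) a} →
        {v | ∃ a ∈ A, v ∈ openCluster (ends '' (↑(t ∪ γ) : Set ι)) a} = {v | ∃ a ∈ A, v ∈ openCluster (ends '' (↑t : Set ι)) a}) ∧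
      (y ∈ {v | ∃ a ∈ A, v ∈ openCluster (ends '' (↑t : Set ι)) a} → γ ≠ ∅ →
        {v | ∃ a ∈ A, v ∈ openCluster (ends '' (↑(t ∪ γ) : Set ι)) a} = insert q {v | ∃ a ∈ A, v ∈ openCluster (ends '' (↑t : Set ι)) a}) := by
    intro A t γ hqA ht hγ
    have hβ : ∀ j ∈ γ, ∃ u : V, ends j = s(u, y) := fun j hj => ⟨q, endsCq j (hγ hj)⟩
    constructor
    · intro hy
      -- if `y` were reached in `t ∪ γ` it would be reached in `t` (closure argument of `setCluster_union_eq_of_not_mem`)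
      by_cases hy' : y ∈ {v | ∃ a ∈ A, v ∈ openCluster (ends '' (↑(t ∪ γ) : Set ι)) a}
      · -- the set `R_A(t)` together with nothing else is closed under `t ∪ γ`: every `γ` edge is `{q,y}` and neither end lies in `R_A(t)`
        exfalso
        have hcl : {v | ∃ a ∈ A, v ∈ openCluster (ends '' (↑(t ∪ γ) : Set ι)) a} ⊆ {v | ∃ a ∈ A, v ∈ openCluster (ends '' (↑t : Set ι)) a} := by
          refine setCluster_subset_of_closed ends (subset_setCluster ends A t) fun i hi u w huw hu => ?_
          rcases Finset.mem_union.mp hi with hit | hiγ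
          · exact setCluster_step ends A hit huw hu
          · exfalso
            have h' := endsCq i (hγ hiγ)
            rw [huw] at h'
            rcases Sym2.eq_iff.mp h' with ⟨huq, _⟩ | ⟨huy, _⟩
            · exact q_notin A t hqA ht (huq ▸ hu)
            · exact hy (huy ▸ hu)
        exact hy (hcl hy')
      · exact setCluster_union_eq_of_not_mem ends A hβ hy'
    · intro hy hγne
      obtain ⟨j, hj⟩ := Finset.nonempty_of_ne_empty hγne
      refine Set.Subset.antisymm ?_ ?_
      · refine setCluster_subset_of_closed ends ((subset_setCluster ends A t).trans (Set.subset_insert _ _)) fun i hi u w huw hu => ?_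
        rcases Finset.mem_union.mp hi with hit | hiγ
        · rcases Set.mem_insert_iff.mp hu with huq | hu
          · -- an `E₀` edge at `q`: only a loop
            by_cases hwq : w = q
            · exact hwq ▸ Set.mem_insert _ _
            · exact absurd (by rw [huw, huq, Sym2.eq_swap]) (q_isol i (ht hit) w hwq)
          · exact Set.mem_insert_of_mem _ (setCluster_step ends A hit huw hu)
        · have h' := endsCq i (hγ hiγ)
          rw [huw] at h'
          rcases Sym2.eq_iff.mp h' with ⟨_, hwy⟩ | ⟨_, hwq⟩
          · exact Set.mem_insert_of_mem _ (hwy ▸ hy)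
          · exact hwq ▸ Set.mem_insert _ _
      · refine Set.insert_subset ?_ (setCluster_mono ends A Finset.subset_union_left)
        have hyq' : ends j = s(y, q) := by rw [endsCq j (hγ hj), Sym2.eq_swap]
        exact setCluster_step ends A (Finset.mem_union_right _ hj) hyq' (setCluster_mono ends A Finset.subset_union_left hy)
  /- ### the complement decomposes: `E \ (t₀ ∪ γ) = (E₀ \ t₀) ∪ (Cq \ γ)` -/
  have sdiff_eq : ∀ t₀ γ : Finset ι, t₀ ⊆ E₀ → γ ⊆ Cq → E \ (t₀ ∪ γ) = (E₀ \ t₀) ∪ (Cq \ γ) := by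
    intro t₀ γ ht hγ
    ext i
    simp only [Finset.mem_sdiff, Finset.mem_union]
    constructor
    · rintro ⟨hiE, hn⟩
      by_cases hiC : i ∈ Cq
      · exact Or.inr ⟨hiC, fun h => hn (Or.inr h)⟩
      · exact Or.inl ⟨Finset.mem_sdiff.mpr ⟨hiE, hiC⟩, fun h => hn (Or.inl h)⟩
    · rintro (⟨hi0, hn⟩ | ⟨hiC, hn⟩)
      · refine ⟨hE₀E hi0, ?_⟩
        rintro (h | h)
        · exact hn h
        · exact (Finset.mem_sdiff.mp hi0).2 (hγ h)
      · refine ⟨hCqE hiC, ?_⟩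
        rintro (h | h)
        · exact Finset.disjoint_left.mp hdisj (ht h) hiC
        · exact hn h
  -- specialisations to `U` and `S`
  have exU1 : ∀ t γ : Finset ι, t ⊆ E₀ → γ ⊆ Cq → y ∉ RU t → RU (t ∪ γ) = RU t :=
    fun t γ ht hγ hy => (explore U t γ hqU ht hγ).1 hy
  have exU2 : ∀ t γ : Finset ι, t ⊆ E₀ → γ ⊆ Cq → y ∈ RU t → γ ≠ ∅ → RU (t ∪ γ) = insert q (RU t) :=
    fun t γ ht hγ hy hne => (explore U t γ hqU ht hγ).2 hy hne
  have exS1 : ∀ t γ : Finset ι, t ⊆ E₀ → γ ⊆ Cq → y ∉ RS t → RS (t ∪ γ) = RS t :=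
    fun t γ ht hγ hy => (explore S t γ hqS ht hγ).1 hy
  have exS2 : ∀ t γ : Finset ι, t ⊆ E₀ → γ ⊆ Cq → y ∈ RS t → γ ≠ ∅ → RS (t ∪ γ) = insert q (RS t) :=
    fun t γ ht hγ hy hne => (explore S t γ hqS ht hγ).2 hy hne
  /- ### the two instances of the isolated-`q` row on `E₀` -/
  set R1U : Finset ι → Set V := fun t => {v | v ∈ RU t ∨ (v = q ∧ y ∈ RU t)} with hR1U
  set R1S : Finset ι → Set V := fun t => {v | v ∈ RS t ∨ (v = q ∧ y ∈ RS t)} with hR1S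
  set admU0 : Finset ι → Prop := fun t => ¬ (y ∈ RU t ∧ y ∈ RU (E₀ \ t)) with hadmU0
  set admS0 : Finset ι → Prop := fun t => ¬ (y ∈ RS t ∧ y ∈ RU (E₀ \ t)) with hadmS0
  -- the modified functions `X ↦ f(X + q[y ∈ X])`
  set ft : Set V → ℝ := fun X => f {v | v ∈ X ∨ (v = q ∧ y ∈ X)} with hft
  set gt : Set V → ℝ := fun X => g {v | v ∈ X ∨ (v = q ∧ y ∈ X)} with hgt
  have sub_t : ∀ X X' : Set V, X ⊆ X' → {v | v ∈ X ∨ (v = q ∧ y ∈ X)} ⊆ {v | v ∈ X' ∨ (v = q ∧ y ∈ X')} := by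
    rintro X X' h v (hv | ⟨hvq, hy⟩)
    · exact Or.inl (h hv)
    · exact Or.inr ⟨hvq, h hy⟩
  have hft_mono : Monotone ft := fun X X' h => hf (sub_t X X' h)
  have hgt_mono : Monotone gt := fun X X' h => hg (sub_t X X' h)
  have top_m' : ∑ t ∈ E₀.powerset, (if admU0 t then (f (RU t) - f (RU (E₀ \ t))) * (g (RU t) - g (RU (E₀ \ t))) else 0) ≤
      2 * ∑ t ∈ E₀.powerset, (if admS0 t then (f (RS t) - f (RU (E₀ \ t))) * (g (RS t) - g (RU (E₀ \ t))) else 0) := by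
    have iso := rcset_row_two_isolated ends E₀ y q hyq S hyS hqS q_isol f g hf hg
    rw [Finset.sum_filter, Finset.sum_filter] at iso
    exact iso
  have top_t' : ∑ t ∈ E₀.powerset, (if admU0 t then (f (R1U t) - f (R1U (E₀ \ t))) * (g (R1U t) - g (R1U (E₀ \ t))) else 0) ≤
      2 * ∑ t ∈ E₀.powerset, (if admS0 t then (f (R1S t) - f (R1U (E₀ \ t))) * (g (R1S t) - g (R1U (E₀ \ t))) else 0) := by
    have iso := rcset_row_two_isolated ends E₀ y q hyq S hyS hqS q_isol ft gt hft_mono hgt_mono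
    rw [Finset.sum_filter, Finset.sum_filter] at iso
    exact iso
  /- ### decomposition of the two sides over `t = t₀ ∪ γ` -/
  set m : ℝ := ((Cq.powerset.erase ∅).card : ℝ) with hm
  have hm0 : 0 ≤ m := Nat.cast_nonneg _
  rw [Finset.sum_filter, Finset.sum_filter]
  rw [show (∑ s ∈ E.powerset, if admU s then TU s else 0) =
      ∑ t₀ ∈ E₀.powerset, ∑ γ ∈ Cq.powerset, (if admU (t₀ ∪ γ) then TU (t₀ ∪ γ) else 0) by
    rw [← sum_powerset_union_of_disjoint E₀ Cq hdisj (fun s => if admU s then TU s else 0), hEE]]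
  rw [show (∑ s ∈ E.powerset, if admS s then TS s else 0) =
      ∑ t₀ ∈ E₀.powerset, ∑ γ ∈ Cq.powerset, (if admS (t₀ ∪ γ) then TS (t₀ ∪ γ) else 0) by
    rw [← sum_powerset_union_of_disjoint E₀ Cq hdisj (fun s => if admS s then TS s else 0), hEE]]
  -- the `γ`-sums, side `U`
  have innerU : ∀ t₀ ∈ E₀.powerset, ∑ γ ∈ Cq.powerset, (if admU (t₀ ∪ γ) then TU (t₀ ∪ γ) else 0) =
      (if admU0 t₀ then (f (RU t₀) - f (RU (E₀ \ t₀))) * (g (RU t₀) - g (RU (E₀ \ t₀))) +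
        m * ((f (R1U t₀) - f (R1U (E₀ \ t₀))) * (g (R1U t₀) - g (R1U (E₀ \ t₀)))) else 0) := by
    intro t₀ ht₀
    have ht : t₀ ⊆ E₀ := Finset.mem_powerset.mp ht₀
    have hct : E₀ \ t₀ ⊆ E₀ := Finset.sdiff_subset
    have key := pendant_powerset_sum Cq y (fun γ => RU (t₀ ∪ γ)) (fun γ => RU (E \ (t₀ ∪ γ))) (RU t₀) (RU (E₀ \ t₀)) (R1U t₀) (R1U (E₀ \ t₀))
      ?_ ?_ ?_ ?_ ?_ ?_ ?_ ?_ ?_ ?_ f g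
    · convert key using 3
      exact Iff.rfl
    · -- hyR
      intro γ hγ
      by_cases hy : y ∈ RU t₀
      · exact ⟨fun _ => hy, fun _ => setCluster_mono ends U Finset.subset_union_left hy⟩
      · rw [exU1 t₀ γ ht hγ hy]
    · -- hyB
      intro γ hγ
      rw [sdiff_eq t₀ γ ht hγ]
      by_cases hy : y ∈ RU (E₀ \ t₀)
      · exact ⟨fun _ => hy, fun _ => setCluster_mono ends U Finset.subset_union_left hy⟩
      · rw [exU1 (E₀ \ t₀) (Cq \ γ) hct Finset.sdiff_subset hy]
    · intro γ hγ hy; exact exU1 t₀ γ ht hγ hy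
    · rw [Finset.union_empty]
    · intro γ hγ hy hne
      rw [exU2 t₀ γ ht hγ hy hne]
      ext v; simp only [hR1U, Set.mem_insert_iff, Set.mem_setOf_eq]
      constructor
      · rintro (h | h)
        · exact Or.inr ⟨h, hy⟩
        · exact Or.inl h
      · rintro (h | ⟨h, _⟩)
        · exact Or.inr h
        · exact Or.inl h
    · intro γ hγ hy
      rw [sdiff_eq t₀ γ ht hγ]
      exact exU1 (E₀ \ t₀) (Cq \ γ) hct Finset.sdiff_subset hy
    · rw [sdiff_eq t₀ Cq ht subset_rfl, Finset.sdiff_self, Finset.union_empty]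
    · intro γ hγ hy hne
      rw [sdiff_eq t₀ γ ht hγ]
      have hne' : Cq \ γ ≠ ∅ := by
        intro h
        exact hne (Finset.Subset.antisymm hγ (Finset.sdiff_eq_empty_iff_subset.mp h))
      rw [exU2 (E₀ \ t₀) (Cq \ γ) hct Finset.sdiff_subset hy hne']
      ext v; simp only [hR1U, Set.mem_insert_iff, Set.mem_setOf_eq]
      constructor
      · rintro (h | h)
        · exact Or.inr ⟨h, hy⟩
        · exact Or.inl h
      · rintro (h | ⟨h, _⟩)
        · exact Or.inr h
        · exact Or.inl h
    · intro hy
      ext v; simp only [hR1U, Set.mem_setOf_eq]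
      constructor
      · rintro (h | ⟨_, h⟩)
        · exact h
        · exact absurd h hy
      · exact fun h => Or.inl h
    · intro hy
      ext v; simp only [hR1U, Set.mem_setOf_eq]
      constructor
      · rintro (h | ⟨_, h⟩)
        · exact h
        · exact absurd h hy
      · exact fun h => Or.inl h
  -- the `γ`-sums, side `S`
  have innerS : ∀ t₀ ∈ E₀.powerset, ∑ γ ∈ Cq.powerset, (if admS (t₀ ∪ γ) then TS (t₀ ∪ γ) else 0) =
      (if admS0 t₀ then (f (RS t₀) - f (RU (E₀ \ t₀))) * (g (RS t₀) - g (RU (E₀ \ t₀))) +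
        m * ((f (R1S t₀) - f (R1U (E₀ \ t₀))) * (g (R1S t₀) - g (R1U (E₀ \ t₀)))) else 0) := by
    intro t₀ ht₀
    have ht : t₀ ⊆ E₀ := Finset.mem_powerset.mp ht₀
    have hct : E₀ \ t₀ ⊆ E₀ := Finset.sdiff_subset
    have key := pendant_powerset_sum Cq y (fun γ => RS (t₀ ∪ γ)) (fun γ => RU (E \ (t₀ ∪ γ))) (RS t₀) (RU (E₀ \ t₀)) (R1S t₀) (R1U (E₀ \ t₀))
      ?_ ?_ ?_ ?_ ?_ ?_ ?_ ?_ ?_ ?_ f g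
    · convert key using 3
      exact Iff.rfl
    · intro γ hγ
      by_cases hy : y ∈ RS t₀
      · exact ⟨fun _ => hy, fun _ => setCluster_mono ends S Finset.subset_union_left hy⟩
      · rw [exS1 t₀ γ ht hγ hy]
    · intro γ hγ
      rw [sdiff_eq t₀ γ ht hγ]
      by_cases hy : y ∈ RU (E₀ \ t₀)
      · exact ⟨fun _ => hy, fun _ => setCluster_mono ends U Finset.subset_union_left hy⟩
      · rw [exU1 (E₀ \ t₀) (Cq \ γ) hct Finset.sdiff_subset hy]
    · intro γ hγ hy; exact exS1 t₀ γ ht hγ hy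
    · rw [Finset.union_empty]
    · intro γ hγ hy hne
      rw [exS2 t₀ γ ht hγ hy hne]
      ext v; simp only [hR1S, Set.mem_insert_iff, Set.mem_setOf_eq]
      constructor
      · rintro (h | h)
        · exact Or.inr ⟨h, hy⟩
        · exact Or.inl h
      · rintro (h | ⟨h, _⟩)
        · exact Or.inr h
        · exact Or.inl h
    · intro γ hγ hy
      rw [sdiff_eq t₀ γ ht hγ]
      exact exU1 (E₀ \ t₀) (Cq \ γ) hct Finset.sdiff_subset hy
    · rw [sdiff_eq t₀ Cq ht subset_rfl, Finset.sdiff_self, Finset.union_empty]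
    · intro γ hγ hy hne
      rw [sdiff_eq t₀ γ ht hγ]
      have hne' : Cq \ γ ≠ ∅ := by
        intro h
        exact hne (Finset.Subset.antisymm hγ (Finset.sdiff_eq_empty_iff_subset.mp h))
      rw [exU2 (E₀ \ t₀) (Cq \ γ) hct Finset.sdiff_subset hy hne']
      ext v; simp only [hR1U, Set.mem_insert_iff, Set.mem_setOf_eq]
      constructor
      · rintro (h | h)
        · exact Or.inr ⟨h, hy⟩
        · exact Or.inl h
      · rintro (h | ⟨h, _⟩)
        · exact Or.inr h
        · exact Or.inl h
    · intro hy
      ext v; simp only [hR1S, Set.mem_setOf_eq]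
      constructor
      · rintro (h | ⟨_, h⟩)
        · exact h
        · exact absurd h hy
      · exact fun h => Or.inl h
    · intro hy
      ext v; simp only [hR1U, Set.mem_setOf_eq]
      constructor
      · rintro (h | ⟨_, h⟩)
        · exact h
        · exact absurd h hy
      · exact fun h => Or.inl h
  rw [Finset.sum_congr rfl innerU, Finset.sum_congr rfl innerS]
  /- ### conclusion: split the `if`s and use the two top-row instances -/
  have splitU : ∑ t₀ ∈ E₀.powerset, (if admU0 t₀ then (f (RU t₀) - f (RU (E₀ \ t₀))) * (g (RU t₀) - g (RU (E₀ \ t₀))) +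
        m * ((f (R1U t₀) - f (R1U (E₀ \ t₀))) * (g (R1U t₀) - g (R1U (E₀ \ t₀)))) else 0) =
      ∑ t₀ ∈ E₀.powerset, (if admU0 t₀ then (f (RU t₀) - f (RU (E₀ \ t₀))) * (g (RU t₀) - g (RU (E₀ \ t₀))) else 0) +
        m * ∑ t₀ ∈ E₀.powerset, (if admU0 t₀ then (f (R1U t₀) - f (R1U (E₀ \ t₀))) * (g (R1U t₀) - g (R1U (E₀ \ t₀))) else 0) := by
    rw [Finset.mul_sum, ← Finset.sum_add_distrib]
    refine Finset.sum_congr rfl fun t₀ _ => ?_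
    by_cases h : admU0 t₀
    · rw [if_pos h, if_pos h, if_pos h]
    · rw [if_neg h, if_neg h, if_neg h, mul_zero, add_zero]
  have splitS : ∑ t₀ ∈ E₀.powerset, (if admS0 t₀ then (f (RS t₀) - f (RU (E₀ \ t₀))) * (g (RS t₀) - g (RU (E₀ \ t₀))) +
        m * ((f (R1S t₀) - f (R1U (E₀ \ t₀))) * (g (R1S t₀) - g (R1U (E₀ \ t₀)))) else 0) =
      ∑ t₀ ∈ E₀.powerset, (if admS0 t₀ then (f (RS t₀) - f (RU (E₀ \ t₀))) * (g (RS t₀) - g (RU (E₀ \ t₀))) else 0) +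
        m * ∑ t₀ ∈ E₀.powerset, (if admS0 t₀ then (f (R1S t₀) - f (R1U (E₀ \ t₀))) * (g (R1S t₀) - g (R1U (E₀ \ t₀))) else 0) := by
    rw [Finset.mul_sum, ← Finset.sum_add_distrib]
    refine Finset.sum_congr rfl fun t₀ _ => ?_
    by_cases h : admS0 t₀
    · rw [if_pos h, if_pos h, if_pos h]
    · rw [if_neg h, if_neg h, if_neg h, mul_zero, add_zero]
  rw [splitU, splitS]
  nlinarith [top_m', top_t', mul_le_mul_of_nonneg_left top_t' hm0]

end Coefficientwise

end Summit.CriticalPhenomena.PercolationContinuityZ3.Theorems
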